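import Mathlib.Analysis.SpecialFunctions.Pow.Real
import Summits.KontsevichZagierPeriods.KontsevichZagierPeriods.Theorems.SymplecticScissorsVolumeFormOffPlaneCertifiedPairs
import Summits.KontsevichZagierPeriods.KontsevichZagierPeriods.Theorems.SymplecticScissorsVolumeFormOffPlaneCutBoxDecomposition
import Summits.KontsevichZagierPeriods.KontsevichZagierPeriods.Theorems.SymplecticScissorsVolumeFormOffPlaneCornerCertificate
import Summits.KontsevichZagierPeriods.KontsevichZagierPeriods.Theorems.SymplecticScissorsVolumeFormOffPlaneBinomialCertificate

/-!
# `VolumeFormOffPlane` (stmt-KontsevichZagierPeriods-14935) — line `Sketch`,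
stub `stub_bevelledBoxPairs` (pairs of bevelled Λ-boxes: the first non-simplicial class)

Fix multiplicatively independent positive real algebraic numbers `α`, `β`,
`Λ = ℚ log α ⊕ ℚ log β`.  A *bevelled Λ-box* in torus dimension `n + 1` (total dimension
`n + 2`, box coordinates `x ι = p (Fin.castSucc ι)`, slack `z = p (Fin.last (n + 1))`) is the
log-box `{t ι · α^{ua ι} β^{va ι} < x ι < t ι · α^{ub ι} β^{vb ι}}` (`t ι > 0` real algebraic)
cut by one binomial wall `∏ ι, x ι ^ m ι < (∏ ι, t ι ^ m ι) · α^{uc} β^{vc}` (`m ι > 0`), with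
the slack conditions `0 < z`, `z · ∏ x ι < 1`.  Two integrand-`1` representations on bevelled
Λ-boxes with the same value are KZ-equivalent.

Proof (bookkeeping over landed siblings): `certifiedPairsFintype` over the index type
`Finset (Fin (n + 1))` with weights `(-1)^{#S}` and members integrand-`1` representations on the
`2ⁿ⁺¹` CORNER CELLS `{e_S < x, ∏ x ^ m < C, slack}` (`e_S = b` on `S`, `a` off `S`):
* the corner representations exist (`KZ.exists_oneRep`: the cell is `ℚ`-semialgebraic and sits
  in a compact box — `bbp_isSemialgebraic_corner`, `bbp_corner_subset_Icc`);
* the a.e. signed decomposition of the bevelled box into its corner cells is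
  `stub_cutBoxDecomposition`;
* every corner cell is certified (`stub_cornerCertificate` fed with `stub_binomialCertificate`),
  its Λ-datum being `C = (∏ e_S ^ m) · α^{su_S} β^{sv_S}` with
  `su_S = uc − Σ ι, m ι · U_S ι` (`U_S = ub` on `S`, `ua` off `S`), `sv_S` likewise
  (`bbp_datum`).

Sources: M. Kontsevich, D. Zagier, *Periods* (2001), §1.2 (the moves); the bookkeeping
(inclusion–exclusion over corner cells) is folklore.
-/

noncomputable section

open MeasureTheory Set
open Literature.NumberTheory.Transcendental
open Literature.ModelTheory.ExponentialFields

namespace Summit.KontsevichZagierPeriods.SymplecticScissors.LogPolytope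

/-! ## Corner cells: semialgebraic, bounded, represented -/

open MvPolynomial in
/-- A corner cell `{e < x, ∏ x ^ m < K, slack}` with real-algebraic `e`, `K` is
`ℚ`-semialgebraic. [folklore] -/
theorem bbp_isSemialgebraic_corner {N : ℕ} {e : Fin N → ℝ} (m : Fin N → ℕ) {K : ℝ}
    (hea : ∀ ι, IsAlgebraic ℚ (e ι)) (hKa : IsAlgebraic ℚ K) :
    IsSemialgebraic ℚ {p : Fin (N + 1) → ℝ | (∀ ι : Fin N, e ι < p (Fin.castSucc ι)) ∧
      ∏ ι : Fin N, p (Fin.castSucc ι) ^ (m ι) < K ∧ 0 < p (Fin.last N) ∧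
      p (Fin.last N) * ∏ ι : Fin N, p (Fin.castSucc ι) < 1} := by
  -- adapted from `bcb_isSemialgebraic_simplex` (…BinomialCellToBox.lean)
  have hbox : IsSemialgebraic ℚ (⋂ ι ∈ (Finset.univ : Finset (Fin N)),
      {p : Fin (N + 1) → ℝ | e ι < p (Fin.castSucc ι)}) :=
    IsSemialgebraic.biInter _ _ fun ι _ => KZ.isSemialgebraic_setOf_const_lt_apply (hea ι) _
  have hprod := tre_isSemialgebraic_setOf_aeval_lt_const
    (∏ ι : Fin N, X (Fin.castSucc ι) ^ (m ι) : MvPolynomial (Fin (N + 1)) ℚ) hKa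
  have hslack := sxe_isSemialgebraic_slack N
  have hset : {p : Fin (N + 1) → ℝ | (∀ ι : Fin N, e ι < p (Fin.castSucc ι)) ∧
      ∏ ι : Fin N, p (Fin.castSucc ι) ^ (m ι) < K ∧ 0 < p (Fin.last N) ∧
      p (Fin.last N) * ∏ ι : Fin N, p (Fin.castSucc ι) < 1} =
      ((⋂ ι ∈ (Finset.univ : Finset (Fin N)), {p : Fin (N + 1) → ℝ | e ι < p (Fin.castSucc ι)}) ∩
        {x : Fin (N + 1) → ℝ | aeval x
          (∏ ι : Fin N, X (Fin.castSucc ι) ^ (m ι) : MvPolynomial (Fin (N + 1)) ℚ) < K}) ∩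
        {p : Fin (N + 1) → ℝ | 0 < p (Fin.last N) ∧
          p (Fin.last N) * ∏ ι : Fin N, p (Fin.castSucc ι) < 1} := by
    ext p
    simp only [mem_setOf_eq, mem_inter_iff, mem_iInter, Finset.mem_univ, forall_const, map_prod,
      map_pow, aeval_X, and_assoc]
  rw [hset]
  exact (hbox.inter hprod).inter hslack

/-- A corner cell `{e < x, ∏ x ^ m < K, slack}` over a positive corner with positive exponents
lies in a compact box: with `y ι = x ι / e ι ≥ 1` one has `y ι ≤ y ι ^ m ι ≤ ∏ y ^ m < K / ∏ e ^ m`,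
and `z ≤ (∏ e)⁻¹`. [folklore] -/
theorem bbp_corner_subset_Icc {N : ℕ} {e : Fin N → ℝ} {m : Fin N → ℕ} {K : ℝ}
    (he : ∀ ι, 0 < e ι) (hm : ∀ ι, 0 < m ι) :
    {p : Fin (N + 1) → ℝ | (∀ ι : Fin N, e ι < p (Fin.castSucc ι)) ∧
      ∏ ι : Fin N, p (Fin.castSucc ι) ^ (m ι) < K ∧ 0 < p (Fin.last N) ∧
      p (Fin.last N) * ∏ ι : Fin N, p (Fin.castSucc ι) < 1} ⊆
    Icc (0 : Fin (N + 1) → ℝ)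
      (Fin.snoc (fun ι => e ι * (K / ∏ κ, e κ ^ (m κ))) (∏ κ, e κ)⁻¹) := by
  -- adapted from `bcb_simplex_subset_Icc` (…BinomialCellToBox.lean)
  rintro p ⟨hbox, hK, hz, hprod⟩
  have hP : 0 < ∏ κ, e κ := Finset.prod_pos fun κ _ => he κ
  have hPm : 0 < ∏ κ, e κ ^ (m κ) := Finset.prod_pos fun κ _ => pow_pos (he κ) _
  have hx : ∀ ι, 0 < p (Fin.castSucc ι) := fun ι => (he ι).trans (hbox ι)
  have hPle : ∏ κ, e κ ≤ ∏ κ, p (Fin.castSucc κ) :=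
    Finset.prod_le_prod (fun κ _ => (he κ).le) fun κ _ => (hbox κ).le
  have hzle : p (Fin.last N) ≤ (∏ κ, e κ)⁻¹ := by
    rw [le_inv_comm₀ hz hP]
    have h1 : p (Fin.last N) * ∏ κ, e κ < 1 :=
      (mul_le_mul_of_nonneg_left hPle hz.le).trans_lt hprod
    rw [← one_div, le_div_iff₀ hz]
    linarith [mul_comm (p (Fin.last N)) (∏ κ, e κ)]
  -- the ratios `y κ = x κ / e κ ≥ 1`
  have hy1 : ∀ κ, 1 ≤ p (Fin.castSucc κ) / e κ := fun κ => by
    rw [le_div_iff₀ (he κ), one_mul]; exact (hbox κ).le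
  have hym1 : ∀ κ, 1 ≤ (p (Fin.castSucc κ) / e κ) ^ (m κ) := fun κ => one_le_pow₀ (hy1 κ)
  have hyprod : ∏ κ, (p (Fin.castSucc κ) / e κ) ^ (m κ) < K / ∏ κ, e κ ^ (m κ) := by
    simp_rw [div_pow]
    rw [Finset.prod_div_distrib]
    exact (div_lt_div_iff_of_pos_right hPm).mpr hK
  have hxle : ∀ ι, p (Fin.castSucc ι) ≤ e ι * (K / ∏ κ, e κ ^ (m κ)) := by
    intro ι
    have hsingle : (p (Fin.castSucc ι) / e ι) ^ (m ι) ≤ ∏ κ, (p (Fin.castSucc κ) / e κ) ^ (m κ) := by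
      rw [← Finset.mul_prod_erase Finset.univ (fun κ => (p (Fin.castSucc κ) / e κ) ^ (m κ))
        (Finset.mem_univ ι)]
      have h1 : 1 ≤ ∏ κ ∈ Finset.univ.erase ι, (p (Fin.castSucc κ) / e κ) ^ (m κ) :=
        Finset.one_le_prod fun κ _ => hym1 κ
      have h0 : 0 ≤ (p (Fin.castSucc ι) / e ι) ^ (m ι) := zero_le_one.trans (hym1 ι)
      nlinarith
    have hself : p (Fin.castSucc ι) / e ι ≤ (p (Fin.castSucc ι) / e ι) ^ (m ι) :=
      le_self_pow₀ (hy1 ι) (hm ι).ne'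
    have := (hself.trans hsingle).trans hyprod.le
    rwa [div_le_iff₀ (he ι), mul_comm] at this
  constructor
  · intro i
    induction i using Fin.lastCases with
    | last => simpa using hz.le
    | cast ι => simpa using (hx ι).le
  · intro i
    induction i using Fin.lastCases with
    | last => simpa using hzle
    | cast ι => simpa using hxle ι

/-- An integrand-`1` representation on a corner cell `{e < x, ∏ x ^ m < K, slack}` exists
(`e > 0` real algebraic, `m > 0`, `K` real algebraic: semialgebraic and bounded;
`KZ.exists_oneRep`). [folklore] -/
theorem bbp_exists_cornerRep {N : ℕ} {e : Fin N → ℝ} {m : Fin N → ℕ} {K : ℝ} (he : ∀ ι, 0 < e ι)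
    (hea : ∀ ι, IsAlgebraic ℚ (e ι)) (hm : ∀ ι, 0 < m ι) (hKa : IsAlgebraic ℚ K) :
    ∃ r : KZ.IntegralRep (N + 1), r.domain = {p : Fin (N + 1) → ℝ |
      (∀ ι : Fin N, e ι < p (Fin.castSucc ι)) ∧ ∏ ι : Fin N, p (Fin.castSucc ι) ^ (m ι) < K ∧
      0 < p (Fin.last N) ∧ p (Fin.last N) * ∏ ι : Fin N, p (Fin.castSucc ι) < 1} ∧
      r.integrand = fun _ => 1 :=
  KZ.exists_oneRep (bbp_isSemialgebraic_corner m hea hKa)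
    (((measure_mono (bbp_corner_subset_Icc (K := K) he hm)).trans_lt
      isCompact_Icc.measure_lt_top).ne)

/-! ## The Λ-datum of a corner cell -/

/-- `γ ^ w = (∏ ι, (γ ^ W ι) ^ m ι) · γ ^ (w − Σ ι, m ι · W ι)` for `γ > 0` and rational exponents.
[folklore] -/
theorem bbp_rpow_split {N : ℕ} {γ : ℝ} (hγ : 0 < γ) (W : Fin N → ℚ) (m : Fin N → ℕ) (w : ℚ) :
    γ ^ ((w : ℚ) : ℝ) = (∏ ι, (γ ^ ((W ι : ℚ) : ℝ)) ^ (m ι)) *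
      γ ^ (((w - ∑ ι, (m ι : ℚ) * W ι : ℚ)) : ℝ) := by
  have h : ∏ ι, (γ ^ ((W ι : ℚ) : ℝ)) ^ (m ι) = γ ^ (∑ ι, ((m ι : ℚ) : ℝ) * ((W ι : ℚ) : ℝ)) := by
    rw [Real.rpow_sum_of_pos hγ]
    refine Finset.prod_congr rfl fun ι _ => ?_
    rw [← Real.rpow_mul_natCast hγ.le, Rat.cast_natCast, mul_comm]
  rw [h, ← Real.rpow_add hγ]
  congr 1
  push_cast
  ring

/-- The Λ-datum of a corner cell: `(∏ t ^ m) · α^{uc} β^{vc} = (∏ (t · α^U β^V) ^ m) · α^{su} β^{sv}`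
with `su = uc − Σ m · U`, `sv = vc − Σ m · V`. [folklore] -/
theorem bbp_datum {N : ℕ} {α β : ℝ} (hα : 0 < α) (hβ : 0 < β) (t : Fin N → ℝ) (U V : Fin N → ℚ)
    (m : Fin N → ℕ) (uc vc : ℚ) :
    (∏ ι, t ι ^ (m ι)) * (α ^ ((uc : ℚ) : ℝ) * β ^ ((vc : ℚ) : ℝ)) =
      (∏ ι, (t ι * (α ^ ((U ι : ℚ) : ℝ) * β ^ ((V ι : ℚ) : ℝ))) ^ (m ι)) *
        (α ^ (((uc - ∑ ι, (m ι : ℚ) * U ι : ℚ)) : ℝ) *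
          β ^ (((vc - ∑ ι, (m ι : ℚ) * V ι : ℚ)) : ℝ)) := by
  rw [bbp_rpow_split hα U m uc, bbp_rpow_split hβ V m vc]
  simp only [mul_pow, Finset.prod_mul_distrib]
  ring

/-! ## One bevelled box: corner representations, certificates, decomposition -/

/-- **One bevelled Λ-box.** For a bevelled Λ-box `r` there are integrand-`1` representations
`ρ S` on its `2ⁿ⁺¹` corner cells (`S ⊆ Fin (n + 1)`), each carrying a torsion certificate over
Λ-boxes (`stub_cornerCertificate` + `stub_binomialCertificate`, Λ-datum `bbp_datum`), such that
`1_r = Σ_S (-1)^{#S} 1_{ρ S}` almost everywhere (`stub_cutBoxDecomposition`). [folklore] -/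
theorem bbp_side {n : ℕ} {α β : ℝ} (hα : 0 < α) (hβ : 0 < β) (hαa : IsAlgebraic ℚ α)
    (hβa : IsAlgebraic ℚ β) (t : Fin (n + 1) → ℝ) (ua va ub vb : Fin (n + 1) → ℚ)
    (m : Fin (n + 1) → ℕ) (uc vc : ℚ) (r : KZ.IntegralRep (n + 1 + 1))
    (ht : ∀ ι, 0 < t ι) (hta : ∀ ι, IsAlgebraic ℚ (t ι)) (hm : ∀ ι, 0 < m ι)
    (hab : ∀ ι, α ^ ((ua ι : ℚ) : ℝ) * β ^ ((va ι : ℚ) : ℝ) ≤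
      α ^ ((ub ι : ℚ) : ℝ) * β ^ ((vb ι : ℚ) : ℝ))
    (hr : r.domain = {p : Fin (n + 1 + 1) → ℝ | (∀ ι : Fin (n + 1),
        t ι * (α ^ ((ua ι : ℚ) : ℝ) * β ^ ((va ι : ℚ) : ℝ)) < p (Fin.castSucc ι) ∧
        p (Fin.castSucc ι) < t ι * (α ^ ((ub ι : ℚ) : ℝ) * β ^ ((vb ι : ℚ) : ℝ))) ∧
        ∏ ι : Fin (n + 1), p (Fin.castSucc ι) ^ (m ι) <
          (∏ ι, t ι ^ (m ι)) * (α ^ ((uc : ℚ) : ℝ) * β ^ ((vc : ℚ) : ℝ)) ∧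
        0 < p (Fin.last (n + 1)) ∧ p (Fin.last (n + 1)) * ∏ ι : Fin (n + 1), p (Fin.castSucc ι) < 1}) :
    ∃ ρ : Finset (Fin (n + 1)) → KZ.IntegralRep (n + 1 + 1),
      (∀ S, ∀ p ∈ (ρ S).domain, (ρ S).integrand p = 1) ∧
      (∀ S, ∃ (d l : ℕ) (σ : Fin l → KZ.IntegralRep (n + 1 + 1)) (w : Fin l → ℤ), d ≠ 0 ∧
        (∀ j, w j ≠ 0 → ∃ (a : Fin (n + 1) → ℝ) (u v : Fin (n + 1) → ℚ),
          (∀ ξ ∈ (σ j).domain, (σ j).integrand ξ = 1) ∧ (∀ ι, 0 < a ι) ∧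
          (∀ ι, IsAlgebraic ℚ (a ι)) ∧ (∀ ι, 1 < α ^ ((u ι : ℚ) : ℝ) * β ^ ((v ι : ℚ) : ℝ)) ∧
          (σ j).domain = {ξ : Fin (n + 1 + 1) → ℝ | (∀ ι : Fin (n + 1), a ι < ξ (Fin.castSucc ι) ∧
            ξ (Fin.castSucc ι) < a ι * (α ^ ((u ι : ℚ) : ℝ) * β ^ ((v ι : ℚ) : ℝ))) ∧
            0 < ξ (Fin.last (n + 1)) ∧
            ξ (Fin.last (n + 1)) * ∏ ι : Fin (n + 1), ξ (Fin.castSucc ι) < 1}) ∧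
        d • KZ.of (ρ S) - ∑ j, w j • KZ.of (σ j) ∈ KZ.relations) ∧
      (∀ᵐ x : Fin (n + 1 + 1) → ℝ, r.domain.indicator (fun _ => (1 : ℝ)) x =
        ∑ S : Finset (Fin (n + 1)), (((-1 : ℤ) ^ S.card : ℤ) : ℝ) *
          (ρ S).domain.indicator (fun _ => (1 : ℝ)) x) := by
  -- algebraicity / positivity bookkeeping
  have hcor : ∀ uu vv : ℚ, IsAlgebraic ℚ (α ^ ((uu : ℚ) : ℝ) * β ^ ((vv : ℚ) : ℝ)) :=
    fun uu vv => (mxs_rpow_isAlgebraic hα hαa uu).mul (mxs_rpow_isAlgebraic hβ hβa vv)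
  have hcor0 : ∀ uu vv : ℚ, 0 < α ^ ((uu : ℚ) : ℝ) * β ^ ((vv : ℚ) : ℝ) :=
    fun uu vv => mul_pos (Real.rpow_pos_of_pos hα _) (Real.rpow_pos_of_pos hβ _)
  -- the data: lower corner `a`, upper corner `b`, the cut `K`
  set a : Fin (n + 1) → ℝ := fun ι => t ι * (α ^ ((ua ι : ℚ) : ℝ) * β ^ ((va ι : ℚ) : ℝ)) with ha
  set b : Fin (n + 1) → ℝ := fun ι => t ι * (α ^ ((ub ι : ℚ) : ℝ) * β ^ ((vb ι : ℚ) : ℝ)) with hb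
  set K : ℝ := (∏ ι, t ι ^ (m ι)) * (α ^ ((uc : ℚ) : ℝ) * β ^ ((vc : ℚ) : ℝ)) with hK
  have hKa : IsAlgebraic ℚ K := (lbl_isAlgebraic_prod fun ι => (hta ι).pow _).mul (hcor uc vc)
  have hab' : ∀ ι, a ι ≤ b ι := fun ι => mul_le_mul_of_nonneg_left (hab ι) (ht ι).le
  -- the corners `e_S` and their exponents
  have he : ∀ (S : Finset (Fin (n + 1))) ι, 0 < (if ι ∈ S then b ι else a ι) := fun S ι => by
    split_ifs
    · exact mul_pos (ht ι) (hcor0 _ _)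
    · exact mul_pos (ht ι) (hcor0 _ _)
  have hea : ∀ (S : Finset (Fin (n + 1))) ι, IsAlgebraic ℚ (if ι ∈ S then b ι else a ι) :=
    fun S ι => by
    split_ifs
    · exact (hta ι).mul (hcor _ _)
    · exact (hta ι).mul (hcor _ _)
  have heU : ∀ S : Finset (Fin (n + 1)), (fun ι => if ι ∈ S then b ι else a ι) = fun ι =>
      t ι * (α ^ (((fun κ => if κ ∈ S then ub κ else ua κ) ι : ℚ) : ℝ) *
        β ^ (((fun κ => if κ ∈ S then vb κ else va κ) ι : ℚ) : ℝ)) := fun S => by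
    funext ι
    beta_reduce
    split_ifs <;> rfl
  have hdatum : ∀ S : Finset (Fin (n + 1)), K = (∏ ι, (if ι ∈ S then b ι else a ι) ^ (m ι)) *
      (α ^ (((uc - ∑ ι, (m ι : ℚ) * (fun κ => if κ ∈ S then ub κ else ua κ) ι : ℚ)) : ℝ) *
        β ^ (((vc - ∑ ι, (m ι : ℚ) * (fun κ => if κ ∈ S then vb κ else va κ) ι : ℚ)) : ℝ)) :=
    fun S => by
    have h := bbp_datum hα hβ t (fun κ => if κ ∈ S then ub κ else ua κ)
      (fun κ => if κ ∈ S then vb κ else va κ) m uc vc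
    rw [hK, h]
    congr 1
    exact Finset.prod_congr rfl fun ι _ => by rw [show (if ι ∈ S then b ι else a ι) =
      (fun ι => if ι ∈ S then b ι else a ι) ι from rfl, heU S]
  -- the corner representations
  have hex : ∀ S : Finset (Fin (n + 1)), ∃ ρS : KZ.IntegralRep (n + 1 + 1),
      ρS.domain = {q : Fin (n + 1 + 1) → ℝ |
        (∀ ι : Fin (n + 1), (if ι ∈ S then b ι else a ι) < q (Fin.castSucc ι)) ∧
        ∏ ι : Fin (n + 1), q (Fin.castSucc ι) ^ (m ι) < K ∧ 0 < q (Fin.last (n + 1)) ∧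
        q (Fin.last (n + 1)) * ∏ ι : Fin (n + 1), q (Fin.castSucc ι) < 1} ∧
      ρS.integrand = fun _ => 1 := fun S =>
    bbp_exists_cornerRep (e := fun ι => if ι ∈ S then b ι else a ι) (he S) (hea S) hm hKa
  choose ρ hρd hρi using hex
  have hρi' : ∀ S, ∀ p ∈ (ρ S).domain, (ρ S).integrand p = 1 := fun S p _ => by rw [hρi S]
  refine ⟨ρ, hρi', fun S => ?_, ?_⟩
  · -- certificates
    exact stub_cornerCertificate n α β hα hβ hαa hβa stub_binomialCertificate
      (fun ι => if ι ∈ S then b ι else a ι) m K _ _ (ρ S) (he S) (hea S) hm hKa (hdatum S)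
      (hρd S) (hρi' S)
  · -- the a.e. decomposition
    exact stub_cutBoxDecomposition (n + 1) a b m K r ρ hab' hr hρd

/-! ## The stub -/

/-- **Stub (BEVELLED-BOX PAIRS).** For multiplicatively independent positive real algebraic
`α`, `β`, two integrand-`1` representations on bevelled Λ-boxes
`{t ι · α^{ua ι} β^{va ι} < x ι < t ι · α^{ub ι} β^{vb ι}, ∏ x ι ^ m ι < (∏ t ι ^ m ι) · α^{uc} β^{vc},
slack}` (`t > 0` real algebraic, `m > 0`, lower ratio `≤` upper ratio) with equal value are
KZ-equivalent: `certifiedPairsFintype` over `Finset (Fin (n + 1))` with weights `(-1)^{#S}`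
and the certified corner representations of `bbp_side`. [folklore] -/
theorem stub_bevelledBoxPairs : ∀ (n : ℕ) (α β : ℝ), 0 < α → 0 < β → IsAlgebraic ℚ α → IsAlgebraic ℚ β →
    (∀ p q : ℤ, α ^ p * β ^ q = 1 → p = 0 ∧ q = 0) →
    ∀ (t : Fin (n + 1) → ℝ) (ua va ub vb : Fin (n + 1) → ℚ) (m : Fin (n + 1) → ℕ) (uc vc : ℚ)
      (t' : Fin (n + 1) → ℝ) (ua' va' ub' vb' : Fin (n + 1) → ℚ) (m' : Fin (n + 1) → ℕ) (uc' vc' : ℚ)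
      (r r' : KZ.IntegralRep (n + 1 + 1)),
    (∀ ι, 0 < t ι) → (∀ ι, IsAlgebraic ℚ (t ι)) → (∀ ι, 0 < m ι) →
    (∀ ι, α ^ ((ua ι : ℚ) : ℝ) * β ^ ((va ι : ℚ) : ℝ) ≤ α ^ ((ub ι : ℚ) : ℝ) * β ^ ((vb ι : ℚ) : ℝ)) →
    (∀ ι, 0 < t' ι) → (∀ ι, IsAlgebraic ℚ (t' ι)) → (∀ ι, 0 < m' ι) →
    (∀ ι, α ^ ((ua' ι : ℚ) : ℝ) * β ^ ((va' ι : ℚ) : ℝ) ≤ α ^ ((ub' ι : ℚ) : ℝ) * β ^ ((vb' ι : ℚ) : ℝ)) →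
    r.domain = {p : Fin (n + 1 + 1) → ℝ | (∀ ι : Fin (n + 1), t ι * (α ^ ((ua ι : ℚ) : ℝ) * β ^ ((va ι : ℚ) : ℝ)) < p (Fin.castSucc ι) ∧
        p (Fin.castSucc ι) < t ι * (α ^ ((ub ι : ℚ) : ℝ) * β ^ ((vb ι : ℚ) : ℝ))) ∧
        ∏ ι : Fin (n + 1), p (Fin.castSucc ι) ^ (m ι) < (∏ ι, t ι ^ (m ι)) * (α ^ ((uc : ℚ) : ℝ) * β ^ ((vc : ℚ) : ℝ)) ∧
        0 < p (Fin.last (n + 1)) ∧ p (Fin.last (n + 1)) * ∏ ι : Fin (n + 1), p (Fin.castSucc ι) < 1} →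
    r'.domain = {p : Fin (n + 1 + 1) → ℝ | (∀ ι : Fin (n + 1), t' ι * (α ^ ((ua' ι : ℚ) : ℝ) * β ^ ((va' ι : ℚ) : ℝ)) < p (Fin.castSucc ι) ∧
        p (Fin.castSucc ι) < t' ι * (α ^ ((ub' ι : ℚ) : ℝ) * β ^ ((vb' ι : ℚ) : ℝ))) ∧
        ∏ ι : Fin (n + 1), p (Fin.castSucc ι) ^ (m' ι) < (∏ ι, t' ι ^ (m' ι)) * (α ^ ((uc' : ℚ) : ℝ) * β ^ ((vc' : ℚ) : ℝ)) ∧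
        0 < p (Fin.last (n + 1)) ∧ p (Fin.last (n + 1)) * ∏ ι : Fin (n + 1), p (Fin.castSucc ι) < 1} →
    (∀ p ∈ r.domain, r.integrand p = 1) → (∀ p ∈ r'.domain, r'.integrand p = 1) →
    r.value = r'.value → KZ.Equivalent r r' := by
  intro n α β hα hβ hαa hβa hind t ua va ub vb m uc vc t' ua' va' ub' vb' m' uc' vc' r r'
    ht hta hm hab ht' hta' hm' hab' hr hr' h1 h1' hval
  obtain ⟨ρ, hρi, hcert, hdec⟩ := bbp_side hα hβ hαa hβa t ua va ub vb m uc vc r ht hta hm hab hr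
  obtain ⟨ρ', hρi', hcert', hdec'⟩ :=
    bbp_side hα hβ hαa hβa t' ua' va' ub' vb' m' uc' vc' r' ht' hta' hm' hab' hr'
  exact certifiedPairsFintype (n + 1) α β hα hβ hαa hβa hind (Finset (Fin (n + 1)))
    (Finset (Fin (n + 1))) r r' ρ ρ' (fun S => (-1) ^ S.card) (fun S => (-1) ^ S.card) h1 h1'
    hρi hρi' (fun S _ => hcert S) (fun S _ => hcert' S) hdec hdec' hval

end Summit.KontsevichZagierPeriods.SymplecticScissors.LogPolytope

end
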